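import Summits.SmoothPoincare4.SmoothPoincare4.Theorems.CongruenceShadowsAgkCor6SufficiencyStubSeamFormCutoff

/-!
# Stub `stub_seamForm` of line `lp-by-sphere-system-surgery` for crux `AgkCor6Sufficiency`
(item stmt-SmoothPoincare4-10894, routes CongruenceShadows / GroupTrisection; lead reshape r5, A3)

**Seam normalisation of the unit presentations** (Abrams–Gay–Kirby, proof of Thm. 5, normal form
along the seams, for the tree's ambient presentations).  For each seam `m` the normalised
presentation `G (normIdx m)` is modified into `G_norm + χ_m (1 - σ_m - G_norm)`,
`σ_m = G (refIdx m) - 1`, with the seam cutoff `χ_m = θ · ψ(σ_m)` of `exists_seamCutoff`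
(`…StubSeamFormCutoff.lean`) supported in the seam zone `N m` (`…StubSeamFormZone.lean`); the
three zones are made pairwise disjoint by separating the compact seam pieces off `T(9 r₀)`.
The Morse clauses persist (`SpinePresentation`: off the zones `G' = G` near every point, on
`N m` no critical points, value `1` exactly on the seam, `< 1` inside; unit forms on
`T₀ = T(4 r₀)`), and the seam clauses `SeamForms` are those of the cutoffs and zones.

References: Abrams–Gay–Kirby, Geom. Topol. 22 (2018), proof of Thm. 5 [AbramsGayKirby2018];
Gay–Kirby, Geom. Topol. 20 (2016), Def. 1 [GayKirby2016]; Milnor, *Morse theory* (1963), §2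
[Milnor1963].
-/

noncomputable section

-- the prescribed namespace `Summit.<P>.<Sub>.…` duplicates `SmoothPoincare4` (P = Sub)
set_option linter.dupNamespace false

open Set Function Filter
open scoped Manifold ContDiff Topology

namespace Summit.SmoothPoincare4.SmoothPoincare4.Cruxes.AgkCor6Sufficiency.LpBySphereSystemSurgery

open Literature.Topology.FourManifolds

/-! ## The statement (verbatim from the skeleton) -/

/-- **A3 — seam normalisation** at scale `r₀`: starting from unit presentations of the three
sectors (unit on `T(20 r₀)`), modify `G (normIdx m)` along each seam outside `T(5 r₀)` into the
seam form (`G_norm + τ(p/r₀) ℓ_L(|σ|/ε₀) (1 - σ - G_norm)`; critical-point-free for `ε₀` small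
and `L` large), keeping the Morse clauses and the unit forms on `T(4 r₀)`. -/
def SeamFormStmt : Prop :=
  ∀ (X : Type) [TopologicalSpace X] [T2Space X] [SecondCountableTopology X]
    [ChartedSpace (EuclideanSpace ℝ (Fin 4)) X] [IsManifold (𝓡 4) ∞ X] [CompactSpace X]
    (S : Fin 3 → Set X) (u v : X → ℝ) (ρ : X → X) (U O : Set X) (k : ℕ)
    (T : Fin 3 → Set X) (G : Fin 3 → X → ℝ) (Ot : Set X) (rt : ℝ) (tp : X → ℝ → ℝ → X),
    TriNormalForm S 0 1 2 u v ρ U O (fun _ => handleCount 1 k) →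
    UnitSectorForm (S 0) (⋂ l, S l) u v ρ U O (T 0) (G 0) (handleCount 1 k) →
    UnitSectorForm (S 1) (⋂ l, S l) (fun y => v y - u y) (fun y => -u y) ρ U O (T 1) (G 1)
      (handleCount 1 k) →
    UnitSectorForm (S 2) (⋂ l, S l) (fun y => -v y) (fun y => u y - v y) ρ U O (T 2) (G 2)
      (handleCount 1 k) →
    TubeStructure (S 0) (⋂ l, S l) u v ρ O Ot rt tp →
    ∀ r₀ : ℝ, 0 < r₀ → 20 * r₀ ≤ rt → tubeSet Ot u v (20 * r₀) ⊆ T 0 ∩ T 1 ∩ T 2 →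
    ∃ (G' : Fin 3 → X → ℝ) (ε₁ : ℝ) (N : Fin 3 → Set X) (T₀ : Set X),
      G' 0 = G 0 ∧ SpinePresentation S u v ρ U O T₀ G' k ∧ tubeSet Ot u v (4 * r₀) ⊆ T₀ ∧
      SeamForms S u v Ot G' r₀ ε₁ N

/-- The seam `S (m+1) ∩ S (m+2)` is `S (refIdx m) ∩ S (normIdx m)`. -/
theorem seam_eq {X : Type} {S : Fin 3 → Set X} (m : Fin 3) :
    S (m + 1) ∩ S (m + 2) = S (refIdx m) ∩ S (normIdx m) := by
  rcases refIdx_normIdx_eq m with ⟨h1, h2⟩ | ⟨h1, h2⟩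
  · rw [h1, h2]
  · rw [h1, h2, inter_comm]

/-- A point of two different seams lies in all three pieces. -/
theorem mem_iInter_of_two_seams {X : Type} {S : Fin 3 → Set X} {m m' : Fin 3} (hne : m ≠ m')
    {x : X} (hx : x ∈ S (refIdx m) ∩ S (normIdx m)) (hx' : x ∈ S (refIdx m') ∩ S (normIdx m')) :
    x ∈ ⋂ l, S l := by
  refine mem_iInter.2 fun l => ?_
  obtain ⟨h1, h2⟩ := hx
  obtain ⟨h3, h4⟩ := hx'
  fin_cases m <;> fin_cases m' <;> fin_cases l <;> simp_all [refIdx, normIdx]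

/-- The boxes `{p_m > r₀, |q_m| < r₀ / 2}` of two different seams are disjoint. -/
theorem box_disjoint {m m' : Fin 3} (hne : m ≠ m') {a b r₀ : ℝ} (hr₀ : 0 < r₀)
    (h : r₀ < pCo m a b ∧ |qCo m a b| < r₀ / 2) (h' : r₀ < pCo m' a b ∧ |qCo m' a b| < r₀ / 2) :
    False := by
  obtain ⟨h1, h2⟩ := h
  obtain ⟨h3, h4⟩ := h'
  fin_cases m <;> fin_cases m' <;> simp [pCo, qCo] at hne h1 h2 h3 h4 <;>
    first | linarith | (cases abs_cases a <;> linarith)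

/-- **Registered stub `stub_seamForm`** (A3 of line `lp-by-sphere-system-surgery`): seam
normalisation of the unit presentations of a tri-normal form. [cite: AbramsGayKirby2018, proof of Thm. 5] -/
theorem stub_seamForm : SeamFormStmt := by
  intro X _ _ _ _ _ _ S u v ρ U O k T G Ot rt tp hT hU0 hU1 hU2 hTS r₀ hr₀ hrt hsub
  classical
  have hfr := hT.frame
  -- ### the sector-indexed clauses of the three unit presentations
  have hGs : ∀ j, ContMDiff (𝓡 4) 𝓘(ℝ, ℝ) ∞ (G j) := by
    intro j; fin_cases j; exacts [hU0.contMDiff_G, hU1.contMDiff_G, hU2.contMDiff_G]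
  have hG1 : ∀ j, ∀ p ∈ S j, p ∉ interior (S j) → G j p = 1 := by
    intro j; fin_cases j; exacts [hU0.G_eq_one, hU1.G_eq_one, hU2.G_eq_one]
  have hG2 : ∀ j, ∀ p ∈ interior (S j), G j p < 1 := by
    intro j; fin_cases j; exacts [hU0.G_lt_one, hU1.G_lt_one, hU2.G_lt_one]
  have hG3 : ∀ j, ∀ p ∈ S j, p ∉ interior (S j) → p ∉ (⋂ l, S l) →
      ¬ IsMCriticalPt (𝓡 4) (G j) p := by
    intro j; fin_cases j; exacts [hU0.regular_bd, hU1.regular_bd, hU2.regular_bd]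
  have hG4 : ∀ j, ∀ p ∈ interior (S j), IsMCriticalPt (𝓡 4) (G j) p →
      (mhessian (𝓡 4) (G j) p).Nondegenerate := by
    intro j; fin_cases j; exacts [hU0.nondeg, hU1.nondeg, hU2.nondeg]
  have hG5 : ∀ j, ∀ p ∈ S j, p ∈ T j → p ∉ (⋂ l, S l) → ¬ IsMCriticalPt (𝓡 4) (G j) p := by
    intro j; fin_cases j; exacts [hU0.regular_T, hU1.regular_T, hU2.regular_T]
  have hG6 : ∀ j n, (interior (S j) ∩ criticalSetOfIndex (𝓡 4) (G j) n).ncard = handleCount 1 k n := by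
    intro j; fin_cases j; exacts [hU0.count, hU1.count, hU2.count]
  have hhalf : ∀ j, ∀ p ∈ S j, p ∉ (⋂ l, S l) →
      ∃ D : HalfSliceChart (𝓡 4) (S j), p ∈ D.Θ.source ∧ ∀ q ∈ D.Θ.source, q ∉ ⋂ l, S l := by
    intro j; fin_cases j
    exacts [hU0.toSectorNormalForm.half, hU1.toSectorNormalForm.half, hU2.toSectorNormalForm.half]
  have hunit : ∀ j, ∀ x ∈ tubeSet Ot u v (20 * r₀), G j x = unitForm j (u x) (v x) := by
    intro j x hx
    obtain ⟨⟨h0, h1⟩, h2⟩ := hsub hx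
    fin_cases j
    · exact hU0.G_eq x h0
    · exact hU1.G_eq x h1
    · exact hU2.G_eq x h2
  have hT4 : ∀ j, tubeSet Ot u v (4 * r₀) ⊆ T j := by
    intro j x hx
    obtain ⟨⟨h0, h1⟩, h2⟩ := hsub (tubeSet_mono (by linarith) (by linarith) hx)
    fin_cases j; exacts [h0, h1, h2]
  -- ### separating the seam pieces off `T(9 r₀)`
  have hTo : ∀ s, IsOpen (tubeSet Ot u v s) := isOpen_tubeSet hTS hfr
  have hFT9 : (⋂ l, S l) ⊆ tubeSet Ot u v (9 * r₀) := by
    intro x hx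
    obtain ⟨hu0, hv0⟩ := (hfr.memF_iff x (hfr.F_subset_U hx)).1 hx
    exact ⟨hTS.F_subset hx, by rw [hu0, hv0]; nlinarith⟩
  set K : Fin 3 → Set X := fun m =>
    (S (refIdx m) ∩ S (normIdx m)) ∩ (tubeSet Ot u v (9 * r₀))ᶜ with hK
  have hKc : ∀ m, IsCompact (K m) := fun m =>
    ((hT.isCompact _).inter_right (hT.isCompact _).isClosed).inter_right (hTo _).isClosed_compl
  have hKdisj : ∀ m m', m ≠ m' → Disjoint (K m) (K m') := by
    intro m m' hne; rw [Set.disjoint_left]; rintro x ⟨hx, hx9⟩ ⟨hx', -⟩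
    exact hx9 (hFT9 (mem_iInter_of_two_seams hne hx hx'))
  have hsep : ∀ m m', m ≠ m' → SeparatedNhds (K m) (K m') := fun m m' hne =>
    SeparatedNhds.of_isCompact_isCompact (hKc m) (hKc m') (hKdisj m m' hne)
  obtain ⟨U01, U10, hU01o, hU10o, hK01, hK10, hd01⟩ := hsep 0 1 (by decide)
  obtain ⟨U02, U20, hU02o, hU20o, hK02, hK20, hd02⟩ := hsep 0 2 (by decide)
  obtain ⟨U12, U21, hU12o, hU21o, hK12, hK21, hd12⟩ := hsep 1 2 (by decide)
  set Um : Fin 3 → Set X := ![U01 ∩ U02, U10 ∩ U12, U20 ∩ U21] with hUm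
  have hUmo : ∀ m, IsOpen (Um m) := by
    intro m; fin_cases m; exacts [hU01o.inter hU02o, hU10o.inter hU12o, hU20o.inter hU21o]
  have hKUm : ∀ m, K m ⊆ Um m := by
    intro m; fin_cases m
    exacts [subset_inter hK01 hK02, subset_inter hK10 hK12, subset_inter hK20 hK21]
  have hUmdisj : ∀ m m', m ≠ m' → Disjoint (Um m) (Um m') := by
    intro m m' hne
    fin_cases m <;> fin_cases m' <;> simp at hne ⊢
    · exact hd01.mono inter_subset_left inter_subset_left
    · exact hd02.mono inter_subset_right inter_subset_left
    · exact hd01.symm.mono inter_subset_left inter_subset_left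
    · exact hd12.mono inter_subset_right inter_subset_right
    · exact hd02.symm.mono inter_subset_left inter_subset_right
    · exact hd12.symm.mono inter_subset_right inter_subset_right
  have hKUm' : ∀ m, ∀ x ∈ S (refIdx m) ∩ S (normIdx m), x ∉ tubeSet Ot u v (9 * r₀) → x ∈ Um m :=
    fun m x hx hx9 => hKUm m ⟨hx, hx9⟩
  -- ### the seam cutoffs
  choose N χ e hNo he hP2 hP3 hP4 hP5 hP5n hP6 hP7 hP8 hχs hχ01 hχnear hC5 hC6 hC7 hM using
    fun m => exists_seamCutoff hT hGs hG1 hG2 hG3 hhalf hTS hr₀ hrt hunit m (hUmo m) (hKUm' m)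
  have hNdisj : ∀ m m', m ≠ m' → Disjoint (N m) (N m') := by
    intro m m' hne; rw [Set.disjoint_left]; intro x hx hx'
    rcases hP4 m hx with h10 | hU
    · exact box_disjoint hne hr₀ ((hP3 m x h10).1 hx) ((hP3 m' x h10).1 hx')
    · rcases hP4 m' hx' with h10' | hU'
      · exact box_disjoint hne hr₀ ((hP3 m x h10').1 hx) ((hP3 m' x h10').1 hx')
      · exact Set.disjoint_left.1 (hUmdisj m m' hne) hU hU'
  have hχzero : ∀ m x, x ∉ N m → χ m x = 0 := fun m x hx => (hχnear m x hx).self_of_nhds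
  have hχother : ∀ m m', m ≠ m' → ∀ x ∈ N m, χ m' x = 0 := fun m m' hne x hx =>
    hχzero m' x (Set.disjoint_left.1 (hNdisj m m' hne) hx)
  -- ### the new presentations
  set D : Fin 3 → X → ℝ := fun m y => 1 - (G (refIdx m) y - 1) - G (normIdx m) y with hD
  have hDs : ∀ m, ContMDiff (𝓡 4) 𝓘(ℝ, ℝ) ∞ (D m) := fun m =>
    (contMDiff_const.sub ((hGs _).sub contMDiff_const)).sub (hGs _)
  set G' : Fin 3 → X → ℝ := ![G 0, fun y => G 1 y + χ 2 y * D 2 y,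
    fun y => G 2 y + χ 0 y * D 0 y + χ 1 y * D 1 y] with hG'
  have hG'1 : ∀ y, G' 1 y = G 1 y + χ 2 y * D 2 y := fun y => rfl
  have hG'2 : ∀ y, G' 2 y = G 2 y + χ 0 y * D 0 y + χ 1 y * D 1 y := fun y => rfl
  have hG's : ∀ j, ContMDiff (𝓡 4) 𝓘(ℝ, ℝ) ∞ (G' j) := by
    intro j; fin_cases j
    · exact hGs 0
    · exact (hGs 1).add ((hχs 2).mul (hDs 2))
    · exact ((hGs 2).add ((hχs 0).mul (hDs 0))).add ((hχs 1).mul (hDs 1))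
  -- `G' (refIdx m) = G (refIdx m)` on `N m` and on the half-box; `G' (normIdx m)` on `N m`
  have hrefN : ∀ m, ∀ x ∈ N m, G' (refIdx m) x = G (refIdx m) x := by
    intro m x hx; fin_cases m
    · show G' 1 x = G 1 x
      rw [hG'1, hχother 0 2 (by decide) x hx, zero_mul, add_zero]
    all_goals rfl
  have hrefNev : ∀ m, ∀ x ∈ N m, G' (refIdx m) =ᶠ[𝓝 x] fun y => G (refIdx m) y + 0 := by
    intro m x hx
    filter_upwards [(hNo m).mem_nhds hx] with y hy
    rw [hrefN m y hy, add_zero]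
  have hrefT : ∀ m, ∀ x ∈ tubeSet Ot u v (10 * r₀), r₀ / 2 < pCo m (u x) (v x) →
      G' (refIdx m) x = G (refIdx m) x := by
    intro m x hx10 hp; fin_cases m
    · show G' 1 x = G 1 x
      have hx2 : x ∉ N 2 := fun h => by
        obtain ⟨-, hq⟩ := (hP3 2 x hx10).1 h
        simp [pCo, qCo] at hp hq
        cases abs_cases (u x) <;> linarith
      rw [hG'1, hχzero 2 x hx2, zero_mul, add_zero]
    all_goals rfl
  have hnormN : ∀ m, ∀ x ∈ N m, G' (normIdx m) x = G (normIdx m) x + χ m x * D m x := by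
    intro m x hx; fin_cases m
    · show G' 2 x = G 2 x + χ 0 x * D 0 x
      rw [hG'2, hχother 0 1 (by decide) x hx]; ring
    · show G' 2 x = G 2 x + χ 1 x * D 1 x
      rw [hG'2, hχother 1 0 (by decide) x hx]; ring
    · rfl
  have hnormNev : ∀ m, ∀ x ∈ N m,
      G' (normIdx m) =ᶠ[𝓝 x] fun y => G (normIdx m) y + χ m y * D m y := by
    intro m x hx
    filter_upwards [(hNo m).mem_nhds hx] with y hy using hnormN m y hy
  -- off the zones, `G' j = G j` near every point
  have hfar : ∀ j x, (∀ m, normIdx m = j → x ∉ N m) → G' j =ᶠ[𝓝 x] fun y => G j y + 0 := by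
    intro j x hx
    fin_cases j
    · exact Eventually.of_forall fun y => by simp only [add_zero]; rfl
    · filter_upwards [hχnear 2 x (hx 2 rfl)] with y hy
      show G' 1 y = G 1 y + 0
      rw [hG'1, hy]; ring
    · filter_upwards [hχnear 0 x (hx 0 rfl), hχnear 1 x (hx 1 rfl)] with y hy0 hy1
      show G' 2 y = G 2 y + 0
      rw [hG'2, hy0, hy1]; ring
  have hfarv : ∀ j x, (∀ m, normIdx m = j → x ∉ N m) → G' j x = G j x := fun j x hx => by
    simpa using (hfar j x hx).self_of_nhds
  -- no critical points on the zones
  have hMcrit : ∀ m, ∀ x ∈ N m, ¬ IsMCriticalPt (𝓡 4) (G' (normIdx m)) x := fun m x hx =>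
    hM m x hx _ (hG's _) (hnormNev m x hx)
  -- in `N m`: non-interior points of `S_norm` are seam points; interior points have `σ > 0`
  have hseamval : ∀ m, ∀ x ∈ N m, x ∈ S (normIdx m) → x ∉ interior (S (normIdx m)) →
      G (refIdx m) x = 1 := by
    intro m x hx hxS hni
    have h1 : 1 ≤ G (refIdx m) x := (hP8 m x hx).1 hxS
    rcases h1.lt_or_eq with hlt | heq
    · exfalso; apply hni
      have hopen : IsOpen (N m ∩ {y | 1 < G (refIdx m) y}) :=
        (hNo m).inter (isOpen_lt continuous_const (hGs _).continuous)
      exact mem_interior.2 ⟨_, fun y hy => (hP8 m y hy.1).2 hy.2.le, hopen, hx, hlt⟩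
    · exact heq.symm
  have hσpos : ∀ m, ∀ x ∈ N m, x ∈ interior (S (normIdx m)) → 1 < G (refIdx m) x := by
    intro m x hx hint
    have hnr : x ∉ S (refIdx m) := fun h =>
      Set.disjoint_left.1 (hT.disjoint _ _ (refIdx_ne_normIdx m).symm) hint h
    rw [hP7 m x hx] at hnr
    exact not_le.1 hnr
  -- ### the Morse clauses
  have hone : ∀ j, ∀ p ∈ S j, p ∉ interior (S j) → G' j p = 1 := by
    intro j p hp hni
    by_cases h : ∃ m, normIdx m = j ∧ p ∈ N m
    · obtain ⟨m, rfl, hpN⟩ := h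
      rw [hnormN m p hpN]
      have h1 := hseamval m p hpN hp hni
      simp only [hD]
      rw [hG1 _ p hp hni, h1]; ring
    · push Not at h
      rw [hfarv j p h]; exact hG1 j p hp hni
  have hlt : ∀ j, ∀ p ∈ interior (S j), G' j p < 1 := by
    intro j p hp
    by_cases h : ∃ m, normIdx m = j ∧ p ∈ N m
    · obtain ⟨m, rfl, hpN⟩ := h
      rw [hnormN m p hpN]
      have h1 := hG2 _ p hp; have h2 := hσpos m p hpN hp; obtain ⟨c0, c1⟩ := hχ01 m p
      have key : 0 < (1 - χ m p) * (1 - G (normIdx m) p) + χ m p * (G (refIdx m) p - 1) := by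
        rcases c1.lt_or_eq with h | h
        · nlinarith [mul_pos (sub_pos.2 h) (sub_pos.2 h1), mul_nonneg c0 (sub_pos.2 h2).le]
        · rw [h]; linarith
      have heq : G (normIdx m) p + χ m p * D m p =
          1 - ((1 - χ m p) * (1 - G (normIdx m) p) + χ m p * (G (refIdx m) p - 1)) := by
        simp only [hD]; ring
      rw [heq]; linarith
    · push Not at h
      rw [hfarv j p h]; exact hG2 j p hp
  have hregbd : ∀ j, ∀ p ∈ S j, p ∉ interior (S j) → p ∉ (⋂ l, S l) →
      ¬ IsMCriticalPt (𝓡 4) (G' j) p := by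
    intro j p hp hni hpF
    by_cases h : ∃ m, normIdx m = j ∧ p ∈ N m
    · obtain ⟨m, rfl, hpN⟩ := h; exact hMcrit m p hpN
    · push Not at h
      rw [isMCriticalPt_congr_of_eventuallyEq_add_const (hfar j p h)]; exact hG3 j p hp hni hpF
  have hregT : ∀ j, ∀ p ∈ S j, p ∈ tubeSet Ot u v (4 * r₀) → p ∉ (⋂ l, S l) →
      ¬ IsMCriticalPt (𝓡 4) (G' j) p := by
    intro j p hp hp4 hpF
    by_cases h : ∃ m, normIdx m = j ∧ p ∈ N m
    · obtain ⟨m, rfl, hpN⟩ := h; exact hMcrit m p hpN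
    · push Not at h
      rw [isMCriticalPt_congr_of_eventuallyEq_add_const (hfar j p h)]
      exact hG5 j p hp (hT4 j hp4) hpF
  have hfar' : ∀ j, ∀ p ∈ interior (S j), IsMCriticalPt (𝓡 4) (G' j) p →
      ∀ m, normIdx m = j → p ∉ N m := by
    intro j p _ hcrit m hm hpN
    subst hm
    exact hMcrit m p hpN hcrit
  have hnondeg : ∀ j, ∀ p ∈ interior (S j), IsMCriticalPt (𝓡 4) (G' j) p →
      (mhessian (𝓡 4) (G' j) p).Nondegenerate := by
    intro j p hp hcrit
    have h := hfar j p (hfar' j p hp hcrit)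
    rw [mhessian_congr_of_eventuallyEq_add_const h]
    rw [isMCriticalPt_congr_of_eventuallyEq_add_const h] at hcrit
    exact hG4 j p hp hcrit
  have hcount : ∀ j n, (interior (S j) ∩ criticalSetOfIndex (𝓡 4) (G' j) n).ncard =
      handleCount 1 k n := by
    intro j n
    have hset : interior (S j) ∩ criticalSetOfIndex (𝓡 4) (G' j) n =
        interior (S j) ∩ criticalSetOfIndex (𝓡 4) (G j) n := by
      ext p
      simp only [mem_inter_iff, mem_criticalSetOfIndex]
      constructor
      · rintro ⟨hint, hcrit, hidx⟩
        have h := hfar j p (hfar' j p hint hcrit)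
        refine ⟨hint, ?_, ?_⟩
        · rwa [isMCriticalPt_congr_of_eventuallyEq_add_const h] at hcrit
        · unfold morseIndex at hidx ⊢
          rwa [mhessian_congr_of_eventuallyEq_add_const h] at hidx
      · rintro ⟨hint, hcrit, hidx⟩
        have hnot : ∀ m, normIdx m = j → p ∉ N m := by
          intro m hm hpN; subst hm; exact hP5n m p hpN hcrit
        have h := hfar j p hnot
        refine ⟨hint, ?_, ?_⟩
        · rwa [isMCriticalPt_congr_of_eventuallyEq_add_const h]
        · unfold morseIndex at hidx ⊢
          rwa [mhessian_congr_of_eventuallyEq_add_const h]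
    rw [hset, hG6 j n]
  -- ### unit forms on `T₀ = T(4 r₀)`
  have hG'T4 : ∀ j, ∀ x ∈ tubeSet Ot u v (4 * r₀), G' j x = G j x := by
    intro j x hx; fin_cases j
    · rfl
    · show G' 1 x = G 1 x
      rw [hG'1, hC6 2 x hx, zero_mul, add_zero]
    · show G' 2 x = G 2 x
      rw [hG'2, hC6 0 x hx, hC6 1 x hx]; ring
  have h4_20 : tubeSet Ot u v (4 * r₀) ⊆ tubeSet Ot u v (20 * r₀) := tubeSet_mono (by linarith) (by linarith)
  have h10_20 : tubeSet Ot u v (10 * r₀) ⊆ tubeSet Ot u v (20 * r₀) := tubeSet_mono (by linarith) (by linarith)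
  -- ### the tolerance
  set ε₁ : ℝ := min (e 0) (min (e 1) (e 2)) with hε₁
  have hε₁pos : 0 < ε₁ := lt_min (he 0) (lt_min (he 1) (he 2))
  have hε₁le : ∀ m, ε₁ ≤ e m := by
    intro m; fin_cases m
    exacts [min_le_left _ _, (min_le_right _ _).trans (min_le_left _ _),
      (min_le_right _ _).trans (min_le_right _ _)]
  -- ### assembly
  refine ⟨G', ε₁, N, tubeSet Ot u v (4 * r₀), rfl, ?_, subset_rfl, ?_⟩
  · exact
    { tri := hT
      isOpen_T₀ := hTo _
      F_subset_T₀ := fun x hx => by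
        obtain ⟨hu0, hv0⟩ := (hfr.memF_iff x (hfr.F_subset_U hx)).1 hx
        exact ⟨hTS.F_subset hx, by rw [hu0, hv0]; nlinarith⟩
      T₀_subset_O := fun x hx => hTS.subset_O hx.1
      contMDiff_G := hG's
      unit := fun j x hx => by rw [hG'T4 j x hx]; exact hunit j x (h4_20 hx)
      G_eq_one := hone
      G_lt_one := hlt
      regular_bd := hregbd
      regular_T₀ := hregT
      nondeg := hnondeg
      count := hcount }
  · exact
    { r₀_pos := hr₀
      ε₁_pos := hε₁pos
      unit := fun j x hx => by rw [hG'T4 j x hx]; exact hunit j x (h4_20 hx)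
      sigma_tube := fun m x hx10 hp _ => by
        rw [hrefT m x hx10 hp, hunit _ x (h10_20 hx10)]; exact unitForm_refIdx m (u x) (v x)
      band := fun m x hx10 hp hσ => by
        have hp' : r₀ / 2 < pCo m (u x) (v x) := by linarith
        rw [hrefT m x hx10 hp'] at hσ ⊢
        obtain ⟨hxN, hχv⟩ := hC5 m x hx10 hp (lt_of_lt_of_le hσ (hε₁le m))
        rw [hnormN m x hxN, hχv]
        have hσv : G (refIdx m) x - 1 = -2 * pCo m (u x) (v x) * qCo m (u x) (v x) := by
          rw [hunit _ x (h10_20 hx10)]; exact unitForm_refIdx m (u x) (v x)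
        have hGn : G (normIdx m) x =
            1 + 2 * pCo m (u x) (v x) * qCo m (u x) (v x) - 2 * qCo m (u x) (v x) ^ 2 := by
          rw [hunit _ x (h10_20 hx10)]; exact unitForm_normIdx m (u x) (v x)
        simp only [hD]
        rw [hσv, hGn]
        unfold bandForm
        have hp0 : pCo m (u x) (v x) ≠ 0 := by linarith
        field_simp
        ring
      isOpen_N := hNo
      seam_subset_N := fun m x hx hx2 => hP2 m x (by rwa [seam_eq m] at hx) hx2
      N_tube := hP3
      regular_N := fun m x hx => by
        rw [isMCriticalPt_congr_of_eventuallyEq_add_const (hrefNev m x hx)]; exact hP5 m x hx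
      seam_form := fun m x hx hx9 hσ => by
        rw [hrefN m x hx] at hσ ⊢
        rw [hnormN m x hx, hC7 m x hx hx9 (lt_of_lt_of_le hσ (hε₁le m))]
        simp only [hD]; ring
      zero_iff := fun m x hx => by rw [hrefN m x hx, seam_eq m]; exact hP6 m x hx
      ref_iff := fun m x hx => by rw [hrefN m x hx]; exact hP7 m x hx
      norm_iff := fun m x hx => by rw [hrefN m x hx]; exact hP8 m x hx
      N_disjoint := hNdisj }

end Summit.SmoothPoincare4.SmoothPoincare4.Cruxes.AgkCor6Sufficiency.LpBySphereSystemSurgery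

end
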